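import Literature.Probability.LatticeModels.MeshColumns
import Literature.Probability.LatticeModels.TriangularLatticeProofs
import Literature.Probability.RandomPlanarGeometry.PlanarDomains
import Mathlib.Topology.Algebra.Module.FiniteDimension
import Mathlib.Analysis.Convex.Segment
import HarnessLib

/-!
# The triangular mesh in lattice coordinates: the shear `1 ↦ 1`, `i ↦ ζ`, antidiagonal rungs, parity

Topic: Probability / LatticeModels (first file of the triangular twin of the series
`MeshColumns` … `MeshDomainJordan`: "the largest component of the discretisation of a Jordan
domain by `δ𝕋` is the bulk"). H21 discretises a planar domain `Ω` at mesh `δ` on the triangular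
lattice `𝕋` by `triMeshDomain Ω δ` (`TriangularLattice.lean`): the union of the components of
maximal cardinality of the graph on the sites `x` with `δ · triEmbed x ∈ Ω`, two `𝕋`-neighbours
being joined when their closed mesh edge lies in `Ω̄`. The real-linear automorphism
`T : 1 ↦ 1, i ↦ ζ = e^{iπ/3}` of `ℂ` (`triLinear`) carries the square mesh point `δ x` to the
triangular mesh point `δ · triEmbed x` (`triLinear_meshPoint`) and segments to segments, so the
triangular discretisation of `Ω` *is* the discretisation of the sheared domain `Ω' = T⁻¹ Ω`
(again a Jordan domain, `JordanDomain.triPreimage`) by the **sheared triangular lattice**: the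
square lattice `ℤ²` together with the antidiagonals `(k, j+1) — (k+1, j)` of its cells
(`latTriMeshGraph`, `triMeshGraph_adj_iff_lat`, `mem_triMeshVertices_iff_lat`). This lets the
whole `ℤ²` apparatus of the `Mesh*` series (cells, perfect cells, windows, good columns,
exterior access) be reused in lattice coordinates; the only new combinatorics is the second kind
of *rung* of a column: besides the horizontal rungs `rung k j` there are the antidiagonal rungs
`drung k j` (`IsKTriRung`), and a `𝕋`-walk changes side of the line `re z = δ(k + ½)` exactly
along a rung of either kind (`isKTriRung_iff_side_ne`, crossing parity `even_kTriRungCount_iff`,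
`odd_kTriRungCount`). Also: a lattice point on a closed sheared unit edge is an endpoint
(`eq_or_eq_of_meshPoint_mem_segment_tri`).

Folklore. Mathlib anchors: `LinearEquiv.toContinuousLinearEquiv`, `Homeomorph.preimage_closure`,
`image_segment`, `SimpleGraph.induce`, `SimpleGraph.Hom`, `List.countP`. Tree anchors: `triZeta`,
`triEmbed`, `triMeshPoint`, `triMeshVertices`, `triMeshGraph`, `triMeshVertexGraph`
(`TriangularLattice.lean`), `triGraph_adj_iff_eq_add` (`TriangularLatticeProofs.lean`), `meshPoint`,
`meshVertices`, `meshGraph`, `meshVertexGraph` (`DomainDiscretisation.lean`), `Mesh.corner`,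
`Mesh.rung`, `Mesh.IsKRung` (`MeshColumns.lean`), `JordanDomain` (`PlanarDomains.lean`).
-/

noncomputable section

open Set Metric Complex

namespace Literature.Probability.LatticeModels

/-! ### The shear `1 ↦ 1`, `i ↦ ζ` -/

/-- `√3 ≠ 0`. [folklore] -/
theorem sqrt_three_ne_zero : Real.sqrt 3 ≠ 0 := (Real.sqrt_pos.2 (by norm_num)).ne'

/-- The real-linear automorphism of `ℂ` with `1 ↦ 1`, `i ↦ ζ = e^{iπ/3}`, as a linear
equivalence; its inverse reads off the lattice coordinates `(re w - im w/√3, 2 im w/√3)`.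
[folklore] -/
def triLinearEquiv : ℂ ≃ₗ[ℝ] ℂ where
  toFun z := (z.re : ℂ) + (z.im : ℂ) * triZeta
  invFun w := ⟨w.re - w.im / Real.sqrt 3, w.im * 2 / Real.sqrt 3⟩
  map_add' z w := by simp only [add_re, add_im, ofReal_add]; ring
  map_smul' c z := by
    simp only [RingHom.id_apply, real_smul, Complex.re_ofReal_mul, Complex.im_ofReal_mul, ofReal_mul]
    ring
  left_inv z := by
    have h3 := sqrt_three_ne_zero
    apply Complex.ext
    · simp only [add_re, ofReal_re, mul_re, ofReal_im, triZeta_re, triZeta_im, zero_mul, sub_zero,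
        add_im, mul_im, add_zero, zero_add]
      field_simp
      ring
    · simp only [add_im, ofReal_im, mul_im, ofReal_re, triZeta_im, triZeta_re, zero_mul, add_zero,
        zero_add]
      field_simp
  right_inv w := by
    have h3 := sqrt_three_ne_zero
    have h3' : Real.sqrt 3 * Real.sqrt 3 = 3 := Real.mul_self_sqrt (by norm_num)
    apply Complex.ext
    · simp only [add_re, ofReal_re, mul_re, ofReal_im, triZeta_re, triZeta_im, zero_mul, sub_zero]
      field_simp
      ring
    · simp only [add_im, ofReal_im, mul_im, ofReal_re, triZeta_im, triZeta_re, zero_mul, add_zero,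
        zero_add]
      field_simp

/-- The shear `T : 1 ↦ 1, i ↦ ζ` as a continuous linear automorphism of `ℂ`. [folklore] -/
def triLinear : ℂ ≃L[ℝ] ℂ := triLinearEquiv.toContinuousLinearEquiv

/-- `T z = re z + (im z) ζ`. [folklore] -/
theorem triLinear_apply (z : ℂ) : triLinear z = (z.re : ℂ) + (z.im : ℂ) * triZeta := rfl

/-- Real part of `T z`. [folklore] -/
theorem triLinear_re (z : ℂ) : (triLinear z).re = z.re + z.im / 2 := by
  rw [triLinear_apply]
  simp only [add_re, ofReal_re, mul_re, ofReal_im, triZeta_re, triZeta_im, zero_mul, sub_zero]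
  ring

/-- Imaginary part of `T z`. [folklore] -/
theorem triLinear_im (z : ℂ) : (triLinear z).im = z.im * (Real.sqrt 3 / 2) := by
  rw [triLinear_apply]
  simp only [add_im, ofReal_im, mul_im, ofReal_re, triZeta_im, triZeta_re, zero_mul, add_zero,
    zero_add]

/-- **The shear carries square mesh points to triangular mesh points**: `T (δ x) = δ · triEmbed x`.
[folklore] -/
theorem triLinear_meshPoint (δ : ℝ) (x : Site 2) : triLinear (meshPoint δ x) = triMeshPoint δ x := by
  rw [triLinear_apply, triMeshPoint, triEmbed, meshPoint_re, meshPoint_im]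
  push_cast
  ring

/-- The shear carries segments to segments. [folklore] -/
theorem triLinear_image_segment (a b : ℂ) :
    triLinear '' segment ℝ a b = segment ℝ (triLinear a) (triLinear b) :=
  image_segment ℝ triLinear.toLinearEquiv.toLinearMap.toAffineMap a b

/-- The shear is a homeomorphism: preimages of closures are closures of preimages. [folklore] -/
theorem triLinear_preimage_closure (Ω : Set ℂ) :
    triLinear ⁻¹' closure Ω = closure (triLinear ⁻¹' Ω) :=
  triLinear.toHomeomorph.preimage_closure Ω

/-- The shear is a homeomorphism: preimages of frontiers are frontiers of preimages. [folklore] -/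
theorem triLinear_preimage_frontier (Ω : Set ℂ) :
    triLinear ⁻¹' frontier Ω = frontier (triLinear ⁻¹' Ω) :=
  triLinear.toHomeomorph.preimage_frontier Ω

/-! ### The sheared triangular mesh graph of a planar domain -/

/-- **The sheared triangular mesh graph** of `Ω'` at mesh `δ`: two `𝕋`-neighbours `x ∼ y` of
the vertex set `ℤ²` are joined iff the closed segment between their *square* mesh points
`δ x`, `δ y` lies in `closure Ω'`. Through the shear `T` this is the triangular mesh graph
`triMeshGraph (T Ω') δ` (`triMeshGraph_adj_iff_lat`). [folklore] -/
def latTriMeshGraph (Ω' : Set ℂ) (δ : ℝ) : SimpleGraph (Site 2) :=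
  SimpleGraph.fromRel fun x y =>
    triGraph.Adj x y ∧ segment ℝ (meshPoint δ x) (meshPoint δ y) ⊆ closure Ω'

/-- Adjacency in the sheared triangular mesh graph, unfolded. [folklore] -/
theorem latTriMeshGraph_adj_iff {Ω' : Set ℂ} {δ : ℝ} {x y : Site 2} :
    (latTriMeshGraph Ω' δ).Adj x y ↔
      triGraph.Adj x y ∧ segment ℝ (meshPoint δ x) (meshPoint δ y) ⊆ closure Ω' := by
  simp only [latTriMeshGraph, SimpleGraph.fromRel_adj, ne_eq]
  constructor
  · rintro ⟨-, h | h⟩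
    · exact h
    · exact ⟨h.1.symm, segment_symm ℝ (meshPoint δ y) (meshPoint δ x) ▸ h.2⟩
  · intro h
    exact ⟨h.1.ne, Or.inl h⟩

/-- The sheared triangular mesh graph is a subgraph of `𝕋`. [folklore] -/
theorem latTriMeshGraph_le_triGraph (Ω' : Set ℂ) (δ : ℝ) : latTriMeshGraph Ω' δ ≤ triGraph :=
  fun _ _ h => (latTriMeshGraph_adj_iff.1 h).1

/-- The square mesh graph is a subgraph of the sheared triangular mesh graph. [folklore] -/
theorem meshGraph_le_latTriMeshGraph (Ω' : Set ℂ) (δ : ℝ) : meshGraph Ω' δ ≤ latTriMeshGraph Ω' δ :=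
  fun _ _ h => latTriMeshGraph_adj_iff.2
    ⟨zdGraph_le_triGraph (meshGraph_adj_iff.1 h).1, (meshGraph_adj_iff.1 h).2⟩

/-- The sheared triangular mesh graph induced on the mesh vertices of `Ω'`. [folklore] -/
abbrev latTriVertexGraph (Ω' : Set ℂ) (δ : ℝ) : SimpleGraph (meshVertices Ω' δ) :=
  (latTriMeshGraph Ω' δ).induce (meshVertices Ω' δ)

/-- **Dictionary, vertices**: `x` is a triangular mesh vertex of `Ω` iff it is a square mesh
vertex of `T⁻¹ Ω`. [folklore] -/
theorem mem_triMeshVertices_iff_lat {Ω : Set ℂ} {δ : ℝ} {x : Site 2} :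
    x ∈ triMeshVertices Ω δ ↔ x ∈ meshVertices (triLinear ⁻¹' Ω) δ := by
  rw [mem_triMeshVertices_iff, mem_meshVertices_iff, mem_preimage, triLinear_meshPoint]

/-- **Dictionary, edges**: adjacency in `triMeshGraph Ω δ` is adjacency in the sheared
triangular mesh graph of `T⁻¹ Ω`. [folklore] -/
theorem triMeshGraph_adj_iff_lat {Ω : Set ℂ} {δ : ℝ} {x y : Site 2} :
    (triMeshGraph Ω δ).Adj x y ↔ (latTriMeshGraph (triLinear ⁻¹' Ω) δ).Adj x y := by
  rw [triMeshGraph_adj_iff, latTriMeshGraph_adj_iff, ← triLinear_preimage_closure,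
    ← image_subset_iff, triLinear_image_segment, triLinear_meshPoint, triLinear_meshPoint]

/-- The graph homomorphism from the sheared triangular vertex graph of `T⁻¹ Ω` to the triangular
mesh vertex graph of `Ω` (the identity on sites). [folklore] -/
def latTriToTriHom (Ω : Set ℂ) (δ : ℝ) :
    latTriVertexGraph (triLinear ⁻¹' Ω) δ →g triMeshVertexGraph Ω δ where
  toFun v := ⟨v.1, mem_triMeshVertices_iff_lat.2 v.2⟩
  map_rel' h := triMeshGraph_adj_iff_lat.2 h

/-- The graph homomorphism from the triangular mesh vertex graph of `Ω` to the sheared triangular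
vertex graph of `T⁻¹ Ω` (the identity on sites). [folklore] -/
def triToLatTriHom (Ω : Set ℂ) (δ : ℝ) :
    triMeshVertexGraph Ω δ →g latTriVertexGraph (triLinear ⁻¹' Ω) δ where
  toFun v := ⟨v.1, mem_triMeshVertices_iff_lat.1 v.2⟩
  map_rel' h := triMeshGraph_adj_iff_lat.1 h

/-- The graph homomorphism from the square mesh vertex graph of `Ω'` to its sheared triangular
vertex graph (more edges, same vertices). [folklore] -/
def meshToLatTriHom (Ω' : Set ℂ) (δ : ℝ) : meshVertexGraph Ω' δ →g latTriVertexGraph Ω' δ where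
  toFun v := v
  map_rel' h := meshGraph_le_latTriMeshGraph Ω' δ h

/-- `latTriToTriHom` is the identity on sites. [folklore] -/
@[simp] theorem latTriToTriHom_apply_val (Ω : Set ℂ) (δ : ℝ) (v : meshVertices (triLinear ⁻¹' Ω) δ) :
    ((latTriToTriHom Ω δ v : triMeshVertices Ω δ) : Site 2) = v := rfl

/-- `triToLatTriHom` is the identity on sites. [folklore] -/
@[simp] theorem triToLatTriHom_apply_val (Ω : Set ℂ) (δ : ℝ) (v : triMeshVertices Ω δ) :
    ((triToLatTriHom Ω δ v : meshVertices (triLinear ⁻¹' Ω) δ) : Site 2) = v := rfl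

/-! ### The sheared Jordan domain -/

end Literature.Probability.LatticeModels

namespace Literature.Probability.RandomPlanarGeometry.JordanDomain

open Literature.Probability.LatticeModels

/-- **The sheared Jordan domain** `T⁻¹ D`: the preimage of a Jordan domain under the shear
`T : 1 ↦ 1, i ↦ ζ`, with boundary loop `T⁻¹ ∘ boundary` (a homeomorphism of the plane carries
Jordan domains to Jordan domains). [folklore] -/
def triPreimage (D : JordanDomain) : JordanDomain where
  carrier := triLinear ⁻¹' D.carrier
  boundary := triLinear.symm ∘ D.boundary
  isOpen := D.isOpen.preimage triLinear.continuous
  isBounded := by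
    rw [← triLinear.image_symm_eq_preimage]
    exact (D.isBounded.isCompact_closure.image triLinear.symm.continuous).isBounded.subset
      (image_mono subset_closure)
  isConnected := by
    rw [← triLinear.image_symm_eq_preimage]
    exact D.isConnected.image _ triLinear.symm.continuous.continuousOn
  continuous_boundary := triLinear.symm.continuous.comp D.continuous_boundary
  periodic_boundary := D.periodic_boundary.comp _
  injOn_boundary := fun _ hs _ ht hst => D.injOn_boundary hs ht (triLinear.symm.injective hst)
  range_boundary := by
    rw [Set.range_comp, D.range_boundary, triLinear.image_symm_eq_preimage,
      triLinear_preimage_frontier]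

/-- The carrier of the sheared domain. [folklore] -/
@[simp] theorem triPreimage_carrier (D : JordanDomain) :
    D.triPreimage.carrier = triLinear ⁻¹' D.carrier := rfl

end Literature.Probability.RandomPlanarGeometry.JordanDomain

namespace Literature.Probability.LatticeModels.Mesh

open Literature.Probability.LatticeModels

/-! ### `𝕋`-adjacency in coordinates -/

/-- Two sites of `ℤ²` with the same two coordinates are equal. [folklore] -/
theorem site2_ext' {v w : Site 2} (h0 : v 0 = w 0) (h1 : v 1 = w 1) : v = w := by
  funext l; fin_cases l <;> assumption

/-- **The six neighbours of a site of `𝕋` in coordinates.** [folklore] -/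
theorem triGraph_adj_iff_coord' (x y : Site 2) :
    triGraph.Adj x y ↔
      (y 0 = x 0 + 1 ∧ y 1 = x 1) ∨ (y 0 = x 0 - 1 ∧ y 1 = x 1) ∨
      (y 0 = x 0 ∧ y 1 = x 1 + 1) ∨ (y 0 = x 0 ∧ y 1 = x 1 - 1) ∨
      (y 0 = x 0 + 1 ∧ y 1 = x 1 - 1) ∨ (y 0 = x 0 - 1 ∧ y 1 = x 1 + 1) := by
  rw [triGraph_adj_iff_eq_add]
  have key : ∀ v : Site 2, y = x + v ↔ y 0 = x 0 + v 0 ∧ y 1 = x 1 + v 1 := fun v =>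
    ⟨fun h => by subst h; simp, fun h => site2_ext' (by simp [h.1]) (by simp [h.2])⟩
  simp only [key, Pi.single_eq_same, Pi.neg_apply, triDiag_zero, triDiag_one]
  have h10 : (Pi.single (M := fun _ : Fin 2 => ℤ) 0 (1 : ℤ)) 1 = 0 := by simp
  have h01 : (Pi.single (M := fun _ : Fin 2 => ℤ) 1 (1 : ℤ)) 0 = 0 := by simp
  rw [h10, h01]
  constructor
  · rintro (h | h | h | h | h | h) <;> omega
  · rintro (h | h | h | h | h | h)
    · exact Or.inl (by omega)
    · exact Or.inr (Or.inl (by omega))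
    · exact Or.inr (Or.inr (Or.inl (by omega)))
    · exact Or.inr (Or.inr (Or.inr (Or.inl (by omega))))
    · exact Or.inr (Or.inr (Or.inr (Or.inr (Or.inl (by omega)))))
    · exact Or.inr (Or.inr (Or.inr (Or.inr (Or.inr (by omega)))))

/-! ### Lattice points on sheared unit edges -/

/-- **A lattice point on a closed sheared unit edge is one of its ends**: if `δ v ∈ [δ x, δ y]`
for `𝕋`-neighbours `x ∼ y` (`δ > 0`), then `v = x` or `v = y`. [folklore] -/
theorem eq_or_eq_of_meshPoint_mem_segment_tri {δ : ℝ} (hδ : 0 < δ) {x y v : Site 2}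
    (h : triGraph.Adj x y) (hv : meshPoint δ v ∈ segment ℝ (meshPoint δ x) (meshPoint δ y)) :
    v = x ∨ v = y := by
  obtain ⟨a, b, ha, hb, hab, hv⟩ := hv
  have hre := congrArg Complex.re hv
  have him := congrArg Complex.im hv
  simp only [add_re, smul_re, meshPoint_re, add_im, smul_im, meshPoint_im, smul_eq_mul] at hre him
  have hc0 : a * (x 0 : ℝ) + b * (y 0 : ℝ) = v 0 := by
    have : δ * (a * (x 0 : ℝ) + b * (y 0 : ℝ)) = δ * (v 0 : ℝ) := by rw [← hre]; ring
    exact mul_left_cancel₀ hδ.ne' this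
  have hc1 : a * (x 1 : ℝ) + b * (y 1 : ℝ) = v 1 := by
    have : δ * (a * (x 1 : ℝ) + b * (y 1 : ℝ)) = δ * (v 1 : ℝ) := by rw [← him]; ring
    exact mul_left_cancel₀ hδ.ne' this
  -- in every case one coordinate moves by `±1`, which pins `b ∈ {0, 1}`
  have hb01 : b = 0 ∨ b = 1 := by
    rcases (triGraph_adj_iff_coord' x y).1 h with h' | h' | h' | h' | h' | h'
    all_goals first
      | (have e0 : (y 0 : ℝ) = x 0 + 1 := by exact_mod_cast h'.1
         have key : (v 0 : ℝ) = x 0 + b := by rw [← hc0, e0]; linear_combination (x 0 : ℝ) * hab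
         have h1 : x 0 ≤ v 0 := by exact_mod_cast (by linarith : (x 0 : ℝ) ≤ v 0)
         have h2 : v 0 ≤ x 0 + 1 := by exact_mod_cast (by linarith : (v 0 : ℝ) ≤ x 0 + 1)
         have : v 0 = x 0 ∨ v 0 = x 0 + 1 := by omega
         rcases this with h3 | h3
         · left; have : (v 0 : ℝ) = x 0 := by exact_mod_cast h3
           linarith
         · right; have : (v 0 : ℝ) = x 0 + 1 := by exact_mod_cast h3
           linarith)
      | (have e0 : (y 0 : ℝ) = x 0 - 1 := by exact_mod_cast h'.1
         have key : (v 0 : ℝ) = x 0 - b := by rw [← hc0, e0]; linear_combination (x 0 : ℝ) * hab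
         have h1 : x 0 - 1 ≤ v 0 := by exact_mod_cast (by linarith : (x 0 : ℝ) - 1 ≤ v 0)
         have h2 : v 0 ≤ x 0 := by exact_mod_cast (by linarith : (v 0 : ℝ) ≤ x 0)
         have : v 0 = x 0 ∨ v 0 = x 0 - 1 := by omega
         rcases this with h3 | h3
         · left; have : (v 0 : ℝ) = x 0 := by exact_mod_cast h3
           linarith
         · right; have : (v 0 : ℝ) = x 0 - 1 := by exact_mod_cast h3
           linarith)
      | (have e1 : (y 1 : ℝ) = x 1 + 1 := by exact_mod_cast h'.2
         have key : (v 1 : ℝ) = x 1 + b := by rw [← hc1, e1]; linear_combination (x 1 : ℝ) * hab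
         have h1 : x 1 ≤ v 1 := by exact_mod_cast (by linarith : (x 1 : ℝ) ≤ v 1)
         have h2 : v 1 ≤ x 1 + 1 := by exact_mod_cast (by linarith : (v 1 : ℝ) ≤ x 1 + 1)
         have : v 1 = x 1 ∨ v 1 = x 1 + 1 := by omega
         rcases this with h3 | h3
         · left; have : (v 1 : ℝ) = x 1 := by exact_mod_cast h3
           linarith
         · right; have : (v 1 : ℝ) = x 1 + 1 := by exact_mod_cast h3
           linarith)
      | (have e1 : (y 1 : ℝ) = x 1 - 1 := by exact_mod_cast h'.2
         have key : (v 1 : ℝ) = x 1 - b := by rw [← hc1, e1]; linear_combination (x 1 : ℝ) * hab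
         have h1 : x 1 - 1 ≤ v 1 := by exact_mod_cast (by linarith : (x 1 : ℝ) - 1 ≤ v 1)
         have h2 : v 1 ≤ x 1 := by exact_mod_cast (by linarith : (v 1 : ℝ) ≤ x 1)
         have : v 1 = x 1 ∨ v 1 = x 1 - 1 := by omega
         rcases this with h3 | h3
         · left; have : (v 1 : ℝ) = x 1 := by exact_mod_cast h3
           linarith
         · right; have : (v 1 : ℝ) = x 1 - 1 := by exact_mod_cast h3
           linarith)
  rcases hb01 with rfl | rfl
  · left
    have ha1 : a = 1 := by linarith
    subst ha1
    apply site2_ext'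
    · exact_mod_cast (by linarith : ((v 0 : ℤ) : ℝ) = x 0)
    · exact_mod_cast (by linarith : ((v 1 : ℤ) : ℝ) = x 1)
  · right
    have ha0 : a = 0 := by linarith
    subst ha0
    apply site2_ext'
    · exact_mod_cast (by linarith : ((v 0 : ℤ) : ℝ) = y 0)
    · exact_mod_cast (by linarith : ((v 1 : ℤ) : ℝ) = y 1)

/-! ### Antidiagonal rungs of a column and the crossing parity of `𝕋`-walks -/

/-- The antidiagonal lattice edge `{(k, j+1), (k+1, j)}` of the cell `(k, j)` — the second kind
of *rung* of column `k` on the sheared triangular lattice. [folklore] -/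
def drung (k j : ℤ) : Sym2 (Site 2) := s(corner k j false true, corner k j true false)

/-- `e` is a rung of column `k` of the sheared triangular lattice: a horizontal rung `rung k j` or
an antidiagonal rung `drung k j`. [folklore] -/
def IsKTriRung (k : ℤ) (e : Sym2 (Site 2)) : Prop := IsKRung k e ∨ ∃ j, e = drung k j

/-- Horizontal rungs are triangular rungs. [folklore] -/
theorem IsKRung.isKTriRung {k : ℤ} {e : Sym2 (Site 2)} (h : IsKRung k e) : IsKTriRung k e := Or.inl h

/-- Antidiagonal rungs are triangular rungs. [folklore] -/
theorem isKTriRung_drung (k j : ℤ) : IsKTriRung k (drung k j) := Or.inr ⟨j, rfl⟩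

/-- **A `𝕋`-step is a rung of column `k` exactly when it changes side** with respect to the
vertical line between columns `k` and `k + 1`. [folklore] -/
theorem isKTriRung_iff_side_ne (k : ℤ) {x y : Site 2} (h : triGraph.Adj x y) :
    IsKTriRung k s(x, y) ↔ ¬ (x 0 ≤ k ↔ y 0 ≤ k) := by
  constructor
  · rintro (⟨j, hj⟩ | ⟨j, hj⟩)
    · rw [rung, Sym2.eq_iff] at hj
      rcases hj with ⟨rfl, rfl⟩ | ⟨rfl, rfl⟩ <;> simp
    · rw [drung, Sym2.eq_iff] at hj
      rcases hj with ⟨rfl, rfl⟩ | ⟨rfl, rfl⟩ <;> simp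
  · intro hne
    rcases (triGraph_adj_iff_coord' x y).1 h with h' | h' | h' | h' | h' | h'
    · -- step `+e₀`: `x 0 = k`
      have hx0 : x 0 = k := by omega
      left
      refine ⟨x 1, ?_⟩
      rw [rung, Sym2.eq_iff]
      left
      exact ⟨site2_ext' (by simp [hx0]) (by simp), site2_ext' (by simp; omega) (by simp; omega)⟩
    · -- step `-e₀`: `y 0 = k`
      have hy0 : y 0 = k := by omega
      left
      refine ⟨x 1, ?_⟩
      rw [rung, Sym2.eq_iff]
      right
      exact ⟨site2_ext' (by simp; omega) (by simp), site2_ext' (by simp [hy0]) (by simp; omega)⟩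
    · exfalso; apply hne; rw [h'.1]
    · exfalso; apply hne; rw [h'.1]
    · -- step `+d = (1, -1)`: `x` is the top-left corner `(k, j+1)` of cell `(k, j)`, `j = x 1 - 1`
      have hx0 : x 0 = k := by omega
      right
      refine ⟨x 1 - 1, ?_⟩
      rw [drung, Sym2.eq_iff]
      left
      exact ⟨site2_ext' (by simp [hx0]) (by simp), site2_ext' (by simp; omega) (by simp; omega)⟩
    · -- step `-d`: `y` is the top-left corner
      have hy0 : y 0 = k := by omega
      right
      refine ⟨x 1, ?_⟩
      rw [drung, Sym2.eq_iff]
      right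
      exact ⟨site2_ext' (by simp; omega) (by simp), site2_ext' (by simp [hy0]) (by simp; omega)⟩

open Classical in
/-- The number of rungs of column `k` (of both kinds) traversed by a `𝕋`-walk, with multiplicity.
[folklore] -/
def kTriRungCount (k : ℤ) {u v : Site 2} (W : triGraph.Walk u v) : ℕ :=
  W.edges.countP fun e => decide (IsKTriRung k e)

/-- `kTriRungCount` of the empty walk. [folklore] -/
@[simp] theorem kTriRungCount_nil (k : ℤ) (u : Site 2) :
    kTriRungCount k (SimpleGraph.Walk.nil : triGraph.Walk u u) = 0 := by
  simp [kTriRungCount]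

open Classical in
/-- `kTriRungCount` of a walk with a first step. [folklore] -/
theorem kTriRungCount_cons (k : ℤ) {u v w : Site 2} (h : triGraph.Adj u v) (W : triGraph.Walk v w) :
    kTriRungCount k (SimpleGraph.Walk.cons h W) =
      kTriRungCount k W + (if IsKTriRung k s(u, v) then 1 else 0) := by
  unfold kTriRungCount
  rw [SimpleGraph.Walk.edges_cons, List.countP_cons]
  by_cases hr : IsKTriRung k s(u, v) <;> simp [hr]

/-- **Crossing parity on the sheared triangular lattice.** Along a `𝕋`-walk from `u` to `v`, the
number of traversed rungs of column `k` (horizontal or antidiagonal) is even iff `u` and `v` lie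
on the same side of the vertical line separating columns `k` and `k + 1`. [folklore] -/
theorem even_kTriRungCount_iff (k : ℤ) {u v : Site 2} (W : triGraph.Walk u v) :
    Even (kTriRungCount k W) ↔ (u 0 ≤ k ↔ v 0 ≤ k) := by
  induction W with
  | nil => simp
  | @cons a b c h W ih =>
    rw [kTriRungCount_cons]
    by_cases hr : IsKTriRung k s(a, b)
    · rw [if_pos hr, Nat.even_add_one, ih]
      have := (isKTriRung_iff_side_ne k h).1 hr
      tauto
    · rw [if_neg hr, add_zero, ih]
      have := (isKTriRung_iff_side_ne k h).not.1 hr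
      push Not at this
      tauto

/-- In particular, a `𝕋`-walk from the left of the line to its right traverses an odd number of
rungs of column `k`. [folklore] -/
theorem odd_kTriRungCount (k : ℤ) {u v : Site 2} (W : triGraph.Walk u v) (hu : u 0 ≤ k)
    (hv : k + 1 ≤ v 0) : Odd (kTriRungCount k W) := by
  rw [← Nat.not_even_iff_odd, even_kTriRungCount_iff]
  intro h
  have := h.1 hu
  omega

/-- The two ends of the antidiagonal rung of cell `(k, j)`: mesh points `δ(k, j+1)` and
`δ(k+1, j)`. [folklore] -/
theorem meshPoint_drung_left (δ : ℝ) (k j : ℤ) :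
    meshPoint δ (corner k j false true) = ⟨δ * k, δ * (j + 1)⟩ := by
  apply Complex.ext <;> simp [corner]

/-- The two ends of the antidiagonal rung of cell `(k, j)`. [folklore] -/
theorem meshPoint_drung_right (δ : ℝ) (k j : ℤ) :
    meshPoint δ (corner k j true false) = ⟨δ * (k + 1), δ * j⟩ := by
  apply Complex.ext <;> simp [corner]

/-- Antidiagonal rungs of a column are determined by their cell. [folklore] -/
theorem drung_injective (k : ℤ) : Function.Injective (drung k) := by
  intro j j' h
  rw [drung, drung, Sym2.eq_iff] at h
  rcases h with ⟨-, h2⟩ | ⟨h1, -⟩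
  · have := congrFun h2 1; simpa [corner] using this
  · have := congrFun h1 0; simp [corner] at this

/-- A horizontal rung is not an antidiagonal rung. [folklore] -/
theorem rung_ne_drung (k j j' : ℤ) : rung k j ≠ drung k j' := by
  intro h
  rw [rung, drung, Sym2.eq_iff] at h
  rcases h with ⟨h1, h2⟩ | ⟨h1, h2⟩
  · have a := congrFun h1 1; have b := congrFun h2 1
    simp [corner] at a b; omega
  · have a := congrFun h1 0
    simp [corner] at a

end Literature.Probability.LatticeModels.Mesh
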